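import Summits.BirchSwinnertonDyer.BirchSwinnertonDyer.Theorems.ManinLocalTwoThreeOddTameUnitTwist
import Summits.BirchSwinnertonDyer.BirchSwinnertonDyer.Theorems.ManinLocalTwoThreeKPWitnessSquarefull
import Summits.BirchSwinnertonDyer.BirchSwinnertonDyer.Theorems.ManinLocalTwoThreeKPWitnessLawsHold
import HarnessLib

/-!
# E-es-87± BY NAME at EVERY squarefull level (GIVEN modularity) and `3 ∤ c(W)` for `ā(W) ≠ +1` modulo F₃♮ at `W`

Summit `BirchSwinnertonDyer`, route `ManinLocalTwoThree` (cell bsd-f2-manin), crux C3 `ManinPrimeToThreeAtNine`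
(stmt-BirchSwinnertonDyer-22968).  Cone sequel of `…OddTameUnitTwist` (E-es-87♭⁺ at every level via THEOREM B″) and
`…KPWitnessSquarefull`: the `4 ∣ N` restriction of the ā ≠ +1 row disappears.

* `threeAdicKPWitnessOfKPNeOneSquarefull_of_exists_isNewformOf (hnf) : ThreeAdicKPWitnessOfKPNeOneSquarefull` — es's law
  **E-es-87±** (leaf `…KatoCurveKPWitness`, typer p664596) holds GIVEN the Modularity Theorem `exists_isNewformOf` (the crux's own
  fourth binder, used only for `N = N(W)` ⟹ `W` additive at `3`, `additive_at_three_of_nine_dvd_level`).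
* `not_three_dvd_maninConstant_of_kp_ne_one_squarefull` — **`3 ∤ D.c`** for every lattice-optimal datum of a globally minimal `W` with
  `ā(W) ≠ +1` at a COMPOSITE squarefull level `9 ∣ N` (`q ≠ 3` prime, `q² ∣ N`), modulo F₃♮ at `W` (`KatoFactThreeAtKP W D.f`) and
  `hnf` — via the leaf's `not_three_dvd_maninConstant_of_e87pm_of_kp`; and `…_of_forall_isogeny` at ANY squarefull level for classes
  `3`-torsion-free up to `3`-isogeny (the LEAD's `plusIndexPrimeTo_three_of_forall_isogeny_addOrderOf_ne`).

So on the squarefull habitat of C3 the Kosters–Pannekoek classes ā ∈ {0, −1} are closed modulo F₃♮ (no lattice law); ā = +1 needs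
the ratio-`3` degeneracy index or E-es-68₉ (`…KPWitnessSquarefull`).  HONEST FRAMING: CONDITIONAL on F₃♮ (Literature `def`) and
`hnf`; C3, Manin's conjecture and BSD are NOT proved by this.  No definitions, no named facts, no sorry.
-/

set_option linter.dupNamespace false
set_option autoImplicit false

noncomputable section

open scoped Classical MatrixGroups ModularForm ComplexConjugate

open CongruenceSubgroup Complex Literature.NumberTheory.EllipticCurves
  Literature.NumberTheory.EllipticCurves.ModularForms
  Summit.BirchSwinnertonDyer.Rank1Residual.ManinAdditive.Gamma1Lattice
  Summit.BirchSwinnertonDyer.Rank1Residual.ManinAdditive.KatoCurve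

namespace Summit.BirchSwinnertonDyer.BirchSwinnertonDyer.Theorems.ManinLocalTwoThree

/-- **E-es-87± `ThreeAdicKPWitnessOfKPNeOneSquarefull` holds GIVEN modularity**, at EVERY squarefull level `9 ∣ N` (no `4 ∣ N`):
THEOREM B″ ⟹ E-es-87♭⁺ ⟹ odd-order unit twist ⟹ the Kosters–Pannekoek clause for `ā ≠ +1`. -/
theorem threeAdicKPWitnessOfKPNeOneSquarefull_of_exists_isNewformOf (hnf : exists_isNewformOf) :
    ThreeAdicKPWitnessOfKPNeOneSquarefull :=
  fun W _ _ _ _ D _ h9 hsq h1 hpi ↦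
    threeAdicKPWitness_of_plusIndexPrimeTo_of_kp_ne_one W D (additive_at_three_of_nine_dvd_level hnf D h9) h9 hsq h1 hpi

/-- **ā ≠ +1, NO law, every composite squarefull level**: `3 ∤ c(W)` for every lattice-optimal `W` with `ā(W) ≠ +1` at a
squarefull level `9 ∣ N` carrying a second additive prime `q ≠ 3` (`q² ∣ N`), modulo F₃♮ at `W` and modularity.
[cite: Kato2004Asterisque, Thm. 12.5 (1) (p. 221)] -/
theorem not_three_dvd_maninConstant_of_kp_ne_one_squarefull (hnf : exists_isNewformOf)
    (W : WeierstrassCurve ℚ) [W.IsElliptic] [W.IsGloballyMinimal] {N : ℕ} [NeZero N]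
    (D : ModularParametrizationData W N) (hF : KatoFactThreeAtKP W D.f)
    (hopt : ∀ z ∈ D.L.lattice, ∃ w ∈ periodLattice D.f, z = D.c * w) (h9 : 3 ^ 2 ∣ N) (hsq : IsSquarefull N)
    (h1 : kpSignThree W ≠ 1) {q : ℕ} (hq : q.Prime) (hq3 : q ≠ 3) (hqN : q ^ 2 ∣ N) : ¬ (3 : ℤ) ∣ D.c :=
  not_three_dvd_maninConstant_of_e87pm_of_kp (threeAdicKPWitnessOfKPNeOneSquarefull_of_exists_isNewformOf hnf) W D hF hopt
    h9 hsq h1 hq hq3 hqN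

/-- **ā ≠ +1, NO law, ANY squarefull level, class `3`-torsion-free up to `3`-isogeny** (plus index by the LEAD's cusp lifting up to
isogeny), modulo F₃♮ at `W` and modularity. [cite: Katz1980, Thm. 2 (m = ℓ)] -/
theorem not_three_dvd_maninConstant_of_kp_ne_one_squarefull_of_forall_isogeny (hnf : exists_isNewformOf)
    (W : WeierstrassCurve ℚ) [W.IsElliptic] [W.IsGloballyMinimal] {N : ℕ} [NeZero N]
    (D : ModularParametrizationData W N) (hF : KatoFactThreeAtKP W D.f)
    (hopt : ∀ z ∈ D.L.lattice, ∃ w ∈ periodLattice D.f, z = D.c * w) (h9 : 3 ^ 2 ∣ N) (hsq : IsSquarefull N)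
    (h1 : kpSignThree W ≠ 1)
    (hiso : ∀ (W' : WeierstrassCurve ℚ) [W'.IsElliptic] (g : WeierstrassCurve.Isogeny W W'), g.degree ∣ 3 →
      ∀ Q : W'.toAffine.Point, addOrderOf Q ≠ 3) : ¬ (3 : ℤ) ∣ D.c := by
  have hΩ : W.realPeriodRat = ((|D.c| : ℤ) : ℝ) * plusPeriod D.f := by
    rw [Int.cast_abs]; exact D.realPeriodRat_eq_abs_mul_plusPeriod_of_latticeEq hopt
  have hc0 : D.c ≠ 0 := D.maninConstant_ne_zero_holds
  have hwit : ThreeAdicKPWitness W W D.f :=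
    threeAdicKPWitness_of_plusIndexPrimeTo_of_kp_ne_one W D (additive_at_three_of_nine_dvd_level hnf D h9) h9 hsq h1
      (plusIndexPrimeTo_three_of_forall_isogeny_addOrderOf_ne W D.isNewformOf hiso)
  have h := not_three_dvd_of_katoFactThreeAtKP_of_kpWitness W W D.f |D.c| hF hwit hΩ (abs_ne_zero.mpr hc0)
  exact fun h3 ↦ h ((dvd_abs 3 D.c).mpr h3)


/-! ### Appendix (p3 g9, after `…KPWitnessLawsHold`): the isogeny form WITHOUT the modularity binder -/

/-- **ā ≠ +1 (incl. ā = 0), ANY squarefull level `9 ∣ N`, class `3`-torsion-free up to `3`-isogeny — UNCONDITIONAL in `hnf`**: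
`3 ∤ D.c` modulo F₃♮ at `W` alone (E-es-87± HOLDS, `threeAdicKPWitnessOfKPNeOneSquarefull_holds`; plus index by the LEAD's cusp
lifting up to isogeny `plusIndexPrimeTo_three_of_forall_isogeny_addOrderOf_ne`). [cite: Katz1980, Thm. 2 (m = ℓ)] -/
theorem not_three_dvd_maninConstant_squarefull_of_kp_ne_one_of_forall_isogeny
    (W : WeierstrassCurve ℚ) [W.IsElliptic] [W.IsGloballyMinimal] {N : ℕ} [NeZero N]
    (D : ModularParametrizationData W N) (hF : KatoFactThreeAtKP W D.f)
    (hopt : ∀ z ∈ D.L.lattice, ∃ w ∈ periodLattice D.f, z = D.c * w) (h9 : 3 ^ 2 ∣ N) (hsq : IsSquarefull N)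
    (h1 : kpSignThree W ≠ 1)
    (hiso : ∀ (W' : WeierstrassCurve ℚ) [W'.IsElliptic] (g : WeierstrassCurve.Isogeny W W'), g.degree ∣ 3 →
      ∀ Q : W'.toAffine.Point, addOrderOf Q ≠ 3) : ¬ (3 : ℤ) ∣ D.c := by
  have hΩ : W.realPeriodRat = ((|D.c| : ℤ) : ℝ) * plusPeriod D.f := by
    rw [Int.cast_abs]; exact D.realPeriodRat_eq_abs_mul_plusPeriod_of_latticeEq hopt
  have hc0 : D.c ≠ 0 := D.maninConstant_ne_zero_holds
  have hwit : ThreeAdicKPWitness W W D.f :=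
    threeAdicKPWitnessOfKPNeOneSquarefull_holds W D hopt h9 hsq h1
      (plusIndexPrimeTo_three_of_forall_isogeny_addOrderOf_ne W D.isNewformOf hiso)
  have h := not_three_dvd_of_katoFactThreeAtKP_of_kpWitness W W D.f |D.c| hF hwit hΩ (abs_ne_zero.mpr hc0)
  exact fun h3 ↦ h ((dvd_abs 3 D.c).mpr h3)

end Summit.BirchSwinnertonDyer.BirchSwinnertonDyer.Theorems.ManinLocalTwoThree

end
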